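import Mathlib
import Literature.MathematicalPhysics.QuantumFieldTheory.Luscher2010.TrivializingMaps
import Literature.MathematicalPhysics.QuantumFieldTheory.Luscher2010.FlowActionSeries
import Summits.Ventures.LatticeQCDFlow.TrivializingMaps.SeriesUniqueness
import Summits.Ventures.LatticeQCDFlow.TrivializingMaps.LoopActionSeries
import HarnessLib

/-!
# The trivializing-flow generator of a Wilson-loop action is strictly finite-range, order by order

HONEST FRAMING: exact (Metropolis-corrected) sampling algorithms for lattice gauge theory; figures of merit are
autocorrelation/cost numbers at stated couplings and volumes; no continuum-physics claim.

Lüscher, CMP 293 (2010) 899, §4.5(b) with §4.3: the generator of the trivializing flow is `Z_t = -∂S̃_t`,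
`S̃_t = ∑_k t^k S̃^{(k)}`; by §4.5(b) the order-`k` term is a local sum whose footprint grows linearly in `k`,
so the order-`k` contribution to the generator at a link `e` READS only the links in a ball of radius linear
in `k` around `e`. File `LoopActionSeries` constructed, for every loop action `S = ∑_x ∑_C Re(c_C tr U(C_x))`
in `d ≥ 2`, a Haar-normalised solution `loopSk` of the recursion with `S̃^{(k)} = ∑_x (G^{(k)}_x - ⟨G^{(k)}_x⟩)`,
`G^{(k)}_x ∈ PD (ℓ(k+1)) (linkBall (2ℓ(2k+1)) (x,ν₀))`. This file records the consequence for the generator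
and transfers it to EVERY smooth solution by the uniqueness theorem of `SeriesUniqueness`:

* `linkDeriv_loopSk_mem`: `∂_{e,X} S̃^{(k)} ∈ PD (ℓ(k+1)) (linkBall (4ℓ(2k+1)) e)` — a link derivative of the
  order-`k` term is a link polynomial of degree `≤ ℓ(k+1)` reading only the ball of radius `4ℓ(2k+1)`;
* `IsLuscherSeries.linkDeriv_dependsOn_loop`: for ANY smooth Lüscher series `(S̃'^{(k)}, Ċ'^{(k)})` of the
  same loop action (any basis, any normalisation), `U ↦ ∂^a_e S̃'^{(k)}(U)` on `SU(n)^E` depends only on the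
  links of `linkBall (4ℓ(2k+1)) e` — the read-set input of `MapLocality` for Euler-integrated truncated flows
  of improved (multi-loop) gauge actions, not only the plaquette action;
* `IsLuscherSeries.const_eq_loopConst`, `loopConst_zero`: the constants of any smooth solution are the
  `loopConst` of the construction, `Ċ^{(0)} = -⟨S⟩` (Haar mean of the action).

References: M. Lüscher, CMP 293 (2010) 899 [Luscher2010Trivializing, arXiv:0907.5491], §4.3 (uniqueness "up
to an irrelevant additive constant", eqs. (4.12)–(4.15)), §4.5(b), §5.1 eq. (5.3) (footprint of the
leading generator).
-/

namespace Summit.Ventures.LatticeQCDFlow.TrivializingMaps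

open MeasureTheory
open Literature.MathematicalPhysics.QuantumFieldTheory
open Literature.MathematicalPhysics.QuantumFieldTheory.Luscher2010
open scoped Matrix Matrix.Norms.Frobenius ContDiff

noncomputable section

variable {d n : ℕ} (hd : 2 ≤ d) (B : SuBasis n) (shapes : Finset (PathWord d)) (coef : PathWord d → ℂ)
  (ν₀ : Fin d) (L : ℕ) [NeZero L]

/-- **The order-`k` generator reads a ball of radius `4ℓ(2k+1)`**: `∂_{e,X} S̃^{(k)}` is a link polynomial of
degree `≤ ℓ(k+1)` supported in `linkBall (4ℓ(2k+1)) e` (only the anchors `x` whose ball contains `e`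
contribute, and their balls lie within twice the radius of `e`). [cite: Luscher2010Trivializing, §4.5(b), §5.1 eq. (5.3)] -/
theorem linkDeriv_loopSk_mem (k : ℕ) (e : Edge d L) (X : Matrix (Fin n) (Fin n) ℂ) :
    linkDeriv e X (loopSk hd B shapes coef ν₀ L k) ∈
      PD (n := n) (loopLen shapes * (k + 1)) (linkBall (4 * loopLen shapes * (2 * k + 1)) e) := by
  have h := linkDeriv_finset_sum e X Finset.univ (fun x : Site d L => loopTermN hd B shapes coef ν₀ k x)
    fun x _ => contDiff_loopTermN hd B shapes coef ν₀ k x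
  have hSk : loopSk hd B shapes coef ν₀ L k = fun W => ∑ x : Site d L, loopTermN hd B shapes coef ν₀ k x W := rfl
  rw [hSk, h]
  have hfn : (fun W => ∑ x : Site d L, linkDeriv e X (loopTermN hd B shapes coef ν₀ k x) W) =
      ∑ x : Site d L, linkDeriv e X (loopTermN hd B shapes coef ν₀ k x) := by
    funext W; simp only [Finset.sum_apply]
  rw [hfn]
  refine Submodule.sum_mem _ fun x _ => ?_
  have hm := loopTermN_mem hd B shapes coef ν₀ k x
  by_cases he : e ∈ linkBall (2 * loopLen shapes * (2 * k + 1)) (x, ν₀)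
  · have hsub : linkBall (2 * loopLen shapes * (2 * k + 1)) (x, ν₀) ⊆
        linkBall (4 * loopLen shapes * (2 * k + 1)) e := fun e'' h'' =>
      linkBall_mono (le_of_eq (by ring)) _ (linkBall_add ((mem_linkBall_comm _ _ _).1 he) h'')
    exact linkDeriv_mem_PD e X (PD_mono le_rfl hsub hm)
  · rw [linkDeriv_eq_zero_of_not_mem X hm.2 he]
    exact const_mem_PD _ _ 0

/-- The order-`k` generator component `U ↦ ∂_{e,X} S̃^{(k)}(U)` of the constructed series depends only on the
links of `linkBall (4ℓ(2k+1)) e`. [cite: Luscher2010Trivializing, §4.5(b)] -/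
theorem linkDeriv_loopSk_dependsOn (k : ℕ) (e : Edge d L) (X : Matrix (Fin n) (Fin n) ℂ) :
    DependsOn (fun U : GaugeConfig d L (Matrix.specialUnitaryGroup (Fin n) ℂ) =>
        linkDeriv e X (loopSk hd B shapes coef ν₀ L k) (WilsonFlow.coeConfig U))
      (linkBall (4 * loopLen shapes * (2 * k + 1)) e) := by
  intro U U' hUU'
  exact (linkDeriv_loopSk_mem hd B shapes coef ν₀ L k e X).2 fun i hi => by
    simp only [WilsonFlow.coeConfig_apply, hUU' i hi]

/-- **Every smooth Lüscher series of a loop action has strictly finite-range gradients** (`d ≥ 2`): if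
`(S̃'^{(k)}, Ċ'^{(k)})` is ANY smooth solution of the recursion (4.12)–(4.15) for
`S = ∑_x ∑_C Re(c_C tr U(C_x))`, then on `SU(n)^E` the order-`k` generator component `U ↦ ∂^a_e S̃'^{(k)}(U)`
depends only on the links within plaquette-radius `4ℓ(2k+1)` of `e` (uniqueness of gradients,
`IsLuscherSeries.linkDeriv_eq`, plus `linkDeriv_loopSk_dependsOn`). [cite: Luscher2010Trivializing, §4.3, §4.5(b)] -/
theorem IsLuscherSeries.linkDeriv_dependsOn_loop (hd2 : 2 ≤ d) {Sk : ℕ → AmbConfig d L n → ℝ} {c : ℕ → ℝ}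
    (h : IsLuscherSeries B (loopAction shapes coef) Sk c) (hsm : ∀ k, ContDiff ℝ ∞ (Sk k)) (k : ℕ)
    (e : Edge d L) (a : B.ι) :
    DependsOn (fun U : GaugeConfig d L (Matrix.specialUnitaryGroup (Fin n) ℂ) =>
        linkDeriv e (B.T a) (Sk k) (WilsonFlow.coeConfig U))
      (linkBall (4 * loopLen shapes * (2 * k + 1)) e) := by
  intro U U' hUU'
  have hν : 0 < d := by omega
  have huniq := (IsLuscherSeries.linkDeriv_eq h (isLuscherSeries_loopSk hd2 B shapes coef ⟨0, hν⟩ L) hsm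
    (contDiff_loopSk hd2 B shapes coef ⟨0, hν⟩ L) k).2
  show linkDeriv e (B.T a) (Sk k) (WilsonFlow.coeConfig U) = linkDeriv e (B.T a) (Sk k) (WilsonFlow.coeConfig U')
  rw [huniq e a U, huniq e a U']
  exact linkDeriv_loopSk_dependsOn hd2 B shapes coef ⟨0, hν⟩ L k e (B.T a) hUU'

/-- The constants of any smooth solution are those of the construction (`Ċ^{(k)}` is determined by `S`).
[cite: Luscher2010Trivializing, §4.3 eqs. (4.14)–(4.15)] -/
theorem IsLuscherSeries.const_eq_loopConst {Sk : ℕ → AmbConfig d L n → ℝ} {c : ℕ → ℝ}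
    (h : IsLuscherSeries B (loopAction shapes coef) Sk c) (hsm : ∀ k, ContDiff ℝ ∞ (Sk k)) :
    c = loopConst hd B shapes coef ν₀ L :=
  IsLuscherSeries.const_eq h (isLuscherSeries_loopSk hd B shapes coef ν₀ L) hsm
    (contDiff_loopSk hd B shapes coef ν₀ L)

/-- `Ċ^{(0)} = -⟨S⟩`: the order-zero constant is minus the Haar mean of the action.
[cite: Luscher2010Trivializing, §4.2 eq. (4.9), §4.3 eq. (4.14)] -/
theorem loopConst_zero : loopConst hd B shapes coef ν₀ L 0 = -haarMean (loopAction shapes coef : AmbConfig d L n → ℝ) := by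
  have hint : ∀ x : Site d L, Integrable (fun U : GaugeConfig d L (Matrix.specialUnitaryGroup (Fin n) ℂ) =>
      loopSite (n := n) shapes coef x (WilsonFlow.coeConfig U))
      (trivialMeasure (Matrix.specialUnitaryGroup (Fin n) ℂ) d L) := fun x =>
    integrable_trivialMeasure_of_continuous
      ((contDiff_of_mem_PD (loopSite_mem' (n := n) hd shapes coef ν₀ x)).continuous.comp
        WilsonFlow.continuous_coeConfig)
  show -∑ x : Site d L, haarMean (loopSite (n := n) shapes coef x) = _
  simp only [haarMean]
  rw [← integral_finsetSum _ fun x _ => hint x]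
  rfl

end

end Summit.Ventures.LatticeQCDFlow.TrivializingMaps
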